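import Summits.CriticalPhenomena.CardyFormulaZ2.Theorems.CardyIKTransportIKMixedBoxCrossingTransportStubCylBunch

/-!
# Line `defect-closure-exploration`, reshape v5 (lead c5) — MONOTONICITY IN THE FACE TYPE: the isotropic
# cylinder arcs probability dominates the honeycomb one (crux `IKMixedBoxCrossing`, stmt-CriticalPhenomena-5911)

Definitions-only support file, companion of `…TransportDefs.lean` (p128988, lead c4).  Nothing is asserted: every
`def … : Prop` is a statement the LINE POSITS (a registered stub), never a literature fact; the compositions are
sorry-free.

THE RESHAPE (v5), lead c5 memo `Cruxes/IKMixedBoxCrossing/Lines/defect-closure-exploration-c5.md`.  Reshape v4 left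
the vertical clause of the crux kernel-checked modulo ONE open statement, `UnivCylArcs` (RSW for the isotropic model in
cylinder-arcs form), next to the LANDED `TriCylArcs` (the same bound for the all-honeycomb slab, p130026) — the two
statements have literally the same geometry and differ only in the face type `fun _ => true` / `fun _ => false`.
Exact enumeration and Monte Carlo (lead c5, `compute/transport/`) show that the arcs probability is MONOTONE in the
face types: replacing a honeycomb face column by an isotropic one never decreases `cylArcs`.  By the permutation
invariance of `cylArcs` (landed `CylBunchStub.cylArcs_comp_perm`, from `CylExchange` p130245 + `SlabDeterminacy`
p129884) it suffices to switch the LAST face column, and for the last face column the statement is a ONE-DIMENSIONAL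
inequality about the two explicit column kernels (honeycomb: fresh uniform column, anti-diagonals; isotropic: the
previous column xor a two-state chain of flip weight `√3/2`, fair diagonals) completing a "link" between two families
of interior clusters through the new column — `LastColLinkMono` below (pointwise in the interior configuration; checked
exhaustively for ALL labelled patterns of circumference `L ≤ 9`, i.e. far beyond the planar ones, and by Monte Carlo on
sampled interiors up to `L = 96`).  Hence

  `LastColLinkMono ⟹ LastFaceMono ⟹ (with CylExchange, SlabDeterminacy) ArcsIsoGeHon ⟹ (with TriCylArcs) UnivCylArcs`,

the first arrow a Fubini over the last cell/face column (`CylBunchStub.sum_resLast` bookkeeping), the second an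
induction on the number of isotropic faces, the third one line (`univCylArcs_of_mono`, sorry-free below).
The mechanism (memo §3): a black run of the new column reaches the previous column over its own rows plus ONE extra
row at each end with probabilities `(q, 1-q)` (`q = 1` honeycomb, `q = ½` isotropic); linking two clusters across a gap
costs `2^{-(gap - extensions)}`, CONVEX in the extensions, so the symmetric randomisation wins (Jensen), by more than the
`ρ = 7 - 4√3` colour tilt of the isotropic kernel loses.  ("Touch" events — reaching the new column at all — are NOT
monotone (honeycomb wins), which is why the horizontal clause is not covered by this reshape.)

Also recorded in the memo, not used here: the loop–Yang–Baxter crossing rhombus of the pair (isotropic, honeycomb)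
exists, is unique and is SIGNED (checkerboard pairings `+2 / -1`), so there is no local stochastic star–triangle move
and Grimmett–Manolescu track transport does not port verbatim; and the two face types sit in a one-parameter COMMUTING
family `T(q) = (odd-corner fugacity √(q²-q+1), anti-diagonal probability q)`, `q ∈ [0,1]` (`T(1)` honeycomb, `T(½)`
isotropic, `T(0)` mirrored honeycomb), along which `cylArcs` is numerically monotone on `[½, 1]`.
-/

noncomputable section

namespace Summit.CriticalPhenomena.CardyFormulaZ2.Cruxes.IKMixedBoxCrossing.DefectClosureExploration

open scoped BigOperators Classical
open Finset
open Summit.CriticalPhenomena.CardyFormulaZ2.Theorems.IKLinearTransport.PinnedDiagramExchange (faceWeight)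
open CylBunchStub (colConst splitEquiv)

/-! ## §1 The last face column: weights and the pointwise link inequality -/

/-- Weight of the LAST face column of type `b` (`true`: isotropic) given the colours `ξ` of the previous cell column,
the colours `c` of the last cell column and the flags `f` of the last face column (the factor split off by
`CylBunchStub.cylWeight_succ`). -/
def lastColWeight (b : Bool) (L : ℕ) [NeZero L] (ξ c f : ZMod L → Bool) : ℝ :=
  ∏ r : ZMod L, faceWeight b ((ξ r ^^ c r) ^^ (ξ (r + 1) ^^ c (r + 1))) (f r)

/-- The weighted number of completions `(c, f)` of the event `E` of the wider slab through a last face column of type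
`b`, the interior configuration `y` of the slab of `w` face columns being fixed. -/
def lastColSum {w : ℕ} (b : Bool) (L : ℕ) [NeZero L] (E : Set (CylCfg (w + 1) L)) (y : CylCfg w L) : ℝ :=
  ∑ p : (ZMod L → Bool) × (ZMod L → Bool),
    if (splitEquiv w L).symm (y, p) ∈ E then lastColWeight b L (fun r => y.1 (Fin.last w, r)) p.1 p.2 else 0

/-- POINTWISE LAST-COLUMN LINK MONOTONICITY (the one-dimensional heart of reshape v5): for EVERY interior
configuration of the slab of `w` face columns, the normalised weighted number of completions of the arcs event through
an ISOTROPIC last face column is at least the one through a HONEYCOMB last face column.  (Given the interior, the arcs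
event asks the new column to LINK the interior clusters of the first arc to those of the second; the two kernels are
explicit one-dimensional laws; checked exhaustively for all labelled patterns, `L ≤ 9`.)
  A statement to be proved (registered stub), not asserted here. -/
def LastColLinkMono : Prop :=
  ∀ (w L n : ℕ) [NeZero L], 3 ≤ L → ∀ y : CylCfg w L,
    lastColSum false L (arcsEvent (w + 1) L n) y / colConst false L ≤
      lastColSum true L (arcsEvent (w + 1) L n) y / colConst true L

/-! ## §2 Averaged forms and the compositions -/

/-- LAST-FACE MONOTONICITY (averaged form of `LastColLinkMono`): switching the last face column from honeycomb to
isotropic does not decrease the arcs probability, whatever the other face types.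
  A statement to be proved (registered stub), not asserted here. -/
def LastFaceMono : Prop :=
  ∀ (w L n : ℕ) [NeZero L], 3 ≤ L → ∀ τ : Fin w → Bool,
    cylArcs (w + 1) L (Fin.snoc τ false) n ≤ cylArcs (w + 1) L (Fin.snoc τ true) n

/-- ISOTROPIC ≥ HONEYCOMB for the cylinder arcs probability, same width and circumference.
  A statement to be proved (registered stub), not asserted here. -/
def ArcsIsoGeHon : Prop :=
  ∀ (w L n : ℕ) [NeZero L], 3 ≤ L → cylArcs w L (fun _ => false) n ≤ cylArcs w L (fun _ => true) n

/-- **`UnivCylArcs` from the monotonicity and the LANDED triangular bound** (no `sorry`): the isotropic arcs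
probability dominates the honeycomb one, which `TriCylArcs` bounds below. -/
theorem univCylArcs_of_mono (hM : ArcsIsoGeHon) (hT : TriCylArcs) : UnivCylArcs := by
  obtain ⟨c, hc, h⟩ := hT
  refine ⟨c, hc, fun n L _ hn hL => ?_⟩
  have h3 : 3 ≤ L := by omega
  exact (h n L hn hL).trans (hM ((n - 1) / 2) L n h3)

/-! ## §3 Registered stub names of the reshape v5 (name-keyed aliases) and the registered composition -/

namespace Registered

/-- Alias keyed by the registered stub name (OPEN, the 1D link inequality). -/
abbrev stub_lastColLinkMono : Prop := LastColLinkMono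
/-- Alias keyed by the registered stub name (bookkeeping: Fubini over the last column). -/
abbrev stub_lastFaceMono_of : Prop := LastColLinkMono → LastFaceMono
/-- Alias keyed by the registered stub name (induction on the number of isotropic faces, with the landed permutation
invariance of `cylArcs`). -/
abbrev stub_arcsIsoGeHon_of : Prop := CylExchange → SlabDeterminacy → LastFaceMono → ArcsIsoGeHon

end Registered

/-- **`UnivCylArcs` from the registered stubs of reshape v5 and the landed `CylExchange`, `SlabDeterminacy`,
`TriCylArcs`** (registered composition, no `sorry`). -/
theorem univCylArcs_of_stubs :
    Registered.stub_lastColLinkMono → Registered.stub_lastFaceMono_of → Registered.stub_arcsIsoGeHon_of →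
      Registered.stub_cylExchange → Registered.stub_slabDeterminacy → Registered.stub_triCylArcs →
      Registered.stub_univCylArcs :=
  fun h1 h2 h3 hX hD hT => univCylArcs_of_mono (h3 hX hD (h2 h1)) hT

end Summit.CriticalPhenomena.CardyFormulaZ2.Cruxes.IKMixedBoxCrossing.DefectClosureExploration

end
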